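import Literature.NumberTheory.Sieve.CircleMethodMajorArcsPrimePairClassical
import Literature.NumberTheory.LFunctions.SiegelWalfisz
import HarnessLib

/-!
# MRT Proposition 3.3(i) and the classical prime-pair major arcs, unconditionally

Topic `Literature/NumberTheory/Sieve`; third layer over the named fact
`Literature.NumberTheory.Sieve.MatomakiRadziwillTao2019_prop33i` (`CircleMethodMajorArcs.lean`; Matomäki–Radziwiłł–Tao,
Proc. LMS 118 (2019), Prop. 3.3(i), arXiv:1707.01315 p. 18). Everything here is PROVED, and this
file only composes results of the tree:

* `CircleMethodMajorArcsPrimePairProofs.lean` proves MRT's printed reduction (pp. 20–21)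
  `Literature.MatomakiRadziwillTao2019_prop33i_of_prop41 : prop41 → prop33i` and, through
  `Literature.NumberTheory.Sieve.MatomakiRadziwillTao2019_prop41_of_siegelWalfisz` (`CircleMethodMajorArcsProofs.lean`,
  Nathanson's Lemma 8.3), `Literature.MatomakiRadziwillTao2019_prop33i_of_siegelWalfisz :
  Literature.Parity.siegel_walfisz → prop33i`;
* `Literature/NumberTheory/LFunctions/SiegelWalfisz.lean` proves the Siegel–Walfisz theorem
  `Literature.NumberTheory.LFunctions.siegel_walfisz_holds` (parity.S28; Montgomery–Vaughan Cor. 11.19, via the zero-free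
  region for Dirichlet `L`-functions, Siegel's theorem and Landau's explicit `ψ`-estimate).

Hence

  `theorem MatomakiRadziwillTao2019_prop33i_holds : MatomakiRadziwillTao2019_prop33i`,

and likewise the unconditional forms `primePairMajorArcs_logPow`, `primePairMajorArcs_classical`,
`primePairMajorArcs_classical_eps`, `primePairMajorArcs_classical_eps_conj` of the classical
major-arc evaluation for prime pairs (levels `P = log^{B'} N`, `Q = log^B N`, full sum over `[1, N]`)
of `CircleMethodMajorArcsPrimePairClassical.lean` — in particular, for every fixed `h ≠ 0`, `B > 0`,
`ε > 0`: `|∫_{𝔐(N; log^B N, log^B N)} |S(α)|² e(αh) dα − 𝔖(h) N| ≤ ε N` for all large `N`, with no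
hypothesis left (the major-arc input of the twin-prime instance of the circle method, route
`Parity/BatemanHorn/MinorArcs`, item `MinorarcsTwinMajor`, is the case `h = -2` after
`Literature.NumberTheory.Sieve.singularSeries_pair_holds`, `Literature.goldbachSingularSeries_two`).

The compositions are kept in this separate file so that the circle-method files
(`CircleMethodMajorArcsPrimePairProofs.lean`, `…Classical.lean` and their dependants) do not import
the `L`-function theory behind `siegel_walfisz_holds`.

## References

* K. Matomäki, M. Radziwiłł, T. Tao, *Correlations of the von Mangoldt and higher divisor
  functions I. Long shift ranges*, Proc. LMS 118 (2019) 284–350, arXiv:1707.01315, Prop. 3.3(i)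
  (p. 18), Prop. 4.1 (p. 20), proof of Prop. 3.3(i) (pp. 20–21). [MatomakiRadziwillTao2019]
* A. Walfisz, *Zur additiven Zahlentheorie. II*, Math. Z. 40 (1936), 592–607. [Walfisz1936]
* H. L. Montgomery, R. C. Vaughan, *Multiplicative Number Theory I*, CUP 2007, Cor. 11.19.
  [MontgomeryVaughan2007]
-/

noncomputable section

namespace Literature.NumberTheory.Sieve

/-- **Matomäki–Radziwiłł–Tao 2019, Proposition 3.3(i), PROVED** (major arcs for the
Hardy–Littlewood prime-pair conjecture: for `A > 0`, `0 < ε < 1/2`, `B ≥ 2A`, `B' ≥ 2B + A`,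
`X ≥ 2`, `0 < |h| ≤ X^{1-ε}`,
`∫_{𝔐_{log^B X, X^{-1} log^{B'} X}} |S_{Λ1_{(X,2X]}}(α)|² e(αh) dα = 𝔖(h) X + O(d₂(h)^{O(1)} X log^{-A} X)`):
MRT's printed proof from Prop. 4.1 (`MatomakiRadziwillTao2019_prop33i_of_siegelWalfisz`) composed
with the tree's Siegel–Walfisz theorem `Literature.NumberTheory.LFunctions.siegel_walfisz_holds`. Ineffective (Siegel).
[cite: MatomakiRadziwillTao2019, Prop. 3.3(i), p. 18 (arXiv)] -/
theorem MatomakiRadziwillTao2019_prop33i_holds : MatomakiRadziwillTao2019_prop33i :=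
  MatomakiRadziwillTao2019_prop33i_of_siegelWalfisz LFunctions.siegel_walfisz_holds

open scoped FourierTransform
open MeasureTheory

/-! ### The classical major-arc evaluation for prime pairs, unconditionally -/

/-- **Classical major arcs for prime pairs, levels `P = log^{B'} N`, `Q = log^B N`, PROVED**:
for `B, B' > 0` there are `N₀`, `C ≥ 0` with
`|∫_{𝔐(N; log^{B'} N, log^B N)} |S(α)|² e(αh) dα − 𝔖(h) N| ≤ C d(h)² (N (log^{-B/2} N + log^{-B'} N) + |h|)`
for all `N ≥ N₀` and `0 < |h| ≤ N` (`S = Literature.primeExpSum N`, `𝔐 = Literature.majorArcs`,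
`𝔖(h) = Literature.goldbachSingularSeries |h|`); `Literature.NumberTheory.Sieve.primePairMajorArcs_logPow_of_siegelWalfisz` composed
with `Literature.NumberTheory.LFunctions.siegel_walfisz_holds`. [cite: MatomakiRadziwillTao2019, Prop. 3.3(i) proof, pp. 20–21 (arXiv)] -/
theorem primePairMajorArcs_logPow {B B' : ℝ} (hB : 0 < B) (hB' : 0 < B') :
    ∃ N₀ : ℕ, ∃ C : ℝ, 0 ≤ C ∧ ∀ N : ℕ, N₀ ≤ N → ∀ h : ℤ, h ≠ 0 → (|h| : ℝ) ≤ N →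
      ‖(∫ α in majorArcs N (Real.log N ^ B') (Real.log N ^ B),
            ((‖primeExpSum N α‖ ^ 2 : ℝ) : ℂ) * (𝐞 (α * h) : ℂ)) -
          (goldbachSingularSeries h.natAbs * N : ℂ)‖ ≤
        C * ((Nat.divisors h.natAbs).card : ℝ) ^ 2 *
          (N * (Real.log N ^ (-(B / 2)) + Real.log N ^ (-B')) + |(h : ℝ)|) :=
  primePairMajorArcs_logPow_of_siegelWalfisz LFunctions.siegel_walfisz_holds hB hB'

/-- **Classical major arcs for prime pairs, level `P = Q = log^B N`, PROVED**: for `B > 0` there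
are `N₀`, `C ≥ 0` with
`|∫_{𝔐(N; log^B N, log^B N)} |S(α)|² e(αh) dα − 𝔖(h) N| ≤ C d(h)² (N log^{-B/2} N + |h|)`
for all `N ≥ N₀` and `0 < |h| ≤ N`. [cite: MatomakiRadziwillTao2019, Prop. 3.3(i) proof, pp. 20–21 (arXiv)] -/
theorem primePairMajorArcs_classical {B : ℝ} (hB : 0 < B) :
    ∃ N₀ : ℕ, ∃ C : ℝ, 0 ≤ C ∧ ∀ N : ℕ, N₀ ≤ N → ∀ h : ℤ, h ≠ 0 → (|h| : ℝ) ≤ N →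
      ‖(∫ α in majorArcs N (Real.log N ^ B) (Real.log N ^ B),
            ((‖primeExpSum N α‖ ^ 2 : ℝ) : ℂ) * (𝐞 (α * h) : ℂ)) -
          (goldbachSingularSeries h.natAbs * N : ℂ)‖ ≤
        C * ((Nat.divisors h.natAbs).card : ℝ) ^ 2 * (N * Real.log N ^ (-(B / 2)) + |(h : ℝ)|) :=
  primePairMajorArcs_classical_of_siegelWalfisz LFunctions.siegel_walfisz_holds hB

/-- **Classical major arcs for prime pairs, qualitative form, PROVED**: for every fixed shift
`h ≠ 0`, every `B > 0` and every `ε > 0`,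
`|∫_{𝔐(N; log^B N, log^B N)} |S(α)|² e(αh) dα − 𝔖(h) N| ≤ ε N` for all large `N`.
[cite: MatomakiRadziwillTao2019, Prop. 3.3(i) proof, pp. 20–21 (arXiv)] -/
theorem primePairMajorArcs_classical_eps (h : ℤ) (hh : h ≠ 0) {B : ℝ} (hB : 0 < B) {ε : ℝ}
    (hε : 0 < ε) :
    ∃ N₀ : ℕ, ∀ N : ℕ, N₀ ≤ N →
      ‖(∫ α in majorArcs N (Real.log N ^ B) (Real.log N ^ B),
            ((‖primeExpSum N α‖ ^ 2 : ℝ) : ℂ) * (𝐞 (α * h) : ℂ)) -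
          (goldbachSingularSeries h.natAbs * N : ℂ)‖ ≤ ε * N :=
  primePairMajorArcs_classical_eps_of_siegelWalfisz LFunctions.siegel_walfisz_holds h hh hB hε

/-- The qualitative form with the integrand written `S(α) conj(S(α)) e(αh)`, PROVED. [folklore] -/
theorem primePairMajorArcs_classical_eps_conj (h : ℤ) (hh : h ≠ 0) {B : ℝ} (hB : 0 < B) {ε : ℝ}
    (hε : 0 < ε) :
    ∃ N₀ : ℕ, ∀ N : ℕ, N₀ ≤ N →
      ‖(∫ α in majorArcs N (Real.log N ^ B) (Real.log N ^ B),
            (primeExpSum N α * (starRingEnd ℂ) (primeExpSum N α)) * (𝐞 (α * h) : ℂ)) -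
          (goldbachSingularSeries h.natAbs * N : ℂ)‖ ≤ ε * N :=
  primePairMajorArcs_classical_eps_conj_of_siegelWalfisz LFunctions.siegel_walfisz_holds h hh hB hε

end Literature.NumberTheory.Sieve

end
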